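import Mathlib.Tactic
import Summits.ValiantsHypothesis.ValiantsHypothesis.Theorems.RyserFormula
import Summits.ValiantsHypothesis.ValiantsHypothesis.Theorems.RowPartitionRank
import HarnessLib
import HarnessLib.Audit

/-!
# The depth-4 row-set-multilinear rung of the threshold dial (`A^ΣΠΣΠ_c`)
(decomposition workshop `decomp-valiant`, lens 6 «restricted-models lifting axis», gen 3 — A-side
ladder between the DECIDED depth-3 slice `Theorems.SmThreshold.PerRowLocalHardExp` and the open
road `Theorems.SmThreshold.PerSmHardExp`)

**The model.** A ROW-SET-MULTILINEAR `ΣΠΣΠ` EXPRESSION for `per_n` (`depthFourEval`): a sum over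
`t < s` of products over the BLOCKS of a row partition `π t` (block of row `i` = label `π t i`) of
block polynomials, each given as a sum of `w t` products over the rows of the block of ROW-LOCAL
polynomials `q t b u i ∈ R[x_i1, …, x_in]`. Its size is measured by `Σ_t w t` (the number of inner
product gates up to the factor `n`). Depth 3 is the case `w = 1`, singleton blocks
(`depthFourEval_singleton`).

**What is proved.**
* `PerRowSmlDepthFourHardExp c` (`A^ΣΠΣΠ_c`): along `n = mc` every such expression has
  `Σ_t w t > a·(m+1)^a·4^m`, eventually, for every `a` — the dial statement at rate `2^((2/c)·n)`.
* `not_perRowSmlDepthFourHardExp` : it FAILS for `c ≤ 2` (Ryser's formula is a depth-3, hence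
  depth-4, expression with `Σ_t w t = 2^n ≤ (m+1)·4^m`).
* `rowLocal_hard_of_depthFour` : `A^ΣΠΣΠ_c` implies the depth-3 statement (decided TRUE iff
  `c ≥ 3` in `Theorems.SmThreshold.perRowLocalHardExp_iff_three_le`), so `A^ΣΠΣΠ_c → 3 ≤ c`
  is recorded in `Theorems.SmThreshold`.
* `perRowSmlDepthFourExpHard_iff` : the `∃ c` form lives on `c ≥ 3`.
* `choose_le_size_of_adapted` (the PROVED part of the true side): if one row set `S ≠ ∅` is
  respected by every term (no block of any `π t` meets both `S` and `Sᶜ` — "`S`-adapted", e.g. every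
  generalized Laplace expansion along `S`), then `Σ_t w t ≥ C(n,|S|)`; with `|S| = n/2` this is
  `2^n/(n+1)`, i.e. the dial statement holds for adapted expressions for every `c ≥ 3`. Proof: each
  term splits as `F_t · G_t` with `F_t ∈ F[rows S]`, `G_t ∈ F[rows Sᶜ]`, and the block flattening law
  `Theorems.RowPartitionRank.choose_le_of_perPoly_eq_sum_mul_blockLocal` applies. What remains OPEN
  at depth 4 is exactly the non-adapted case (blocks crossing every balanced cut), where random
  restrictions give only `2^(O(√n))`-type bounds.

STATUS / LITERATURE. For `c ≥ 3` the statement is OPEN: what is KNOWN for multilinear circuits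
of product-depth `d` computing `per_n` (or `det_n`) is the sub-exponential bound `2^(n^Ω(1/d))`
(Raz–Yehudayoff 2009, Thm. 1.1; multilinear formulas of any depth: `n^Ω(log n)`, Raz 2004/2009),
and `2^Ω(n)` only at depth 3 (Nisan–Wigderson, the flattening bound of `Theorems.RowPartitionRank`);
an exponential `2^Ω(n)` bound at depth 4 — let alone at the rate `2^((2/c)·n)` — is not in print,
and super-polynomial lower bounds for set-multilinear ABPs / circuits computing `per_n` are an
explicitly OPEN PROBLEM (Arvind–Raja 2016, Remark 1.1; for sums of `r` read-once ABPs they prove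
`2^Ω(n/r)`, ibid.). `A^ΣΠΣΠ_c` is WEAKER than `PerSmHardExp c` (by multihomogeneity the bottom
polynomials may be replaced by their linear parts, after which an expression of size `S` is a
syntactically multilinear formula of size `O(S·n²)`; this edge is not typed here) and is NOT known
to imply `VP ≠ VNP` (no subexponential depth-4 lift is known). It is filed as the next rung of the
A-side ladder, not as a piece of a decomposition of the summit; its open content is pinned by the
cut-crossing law of `Theorems.CutCrossingLaw`.

HONEST FRAMING: definitions, the Ryser refutation for `c ≤ 2` and the embedding of depth 3; nothing
here is evidence for `VP ≠ VNP`, which is NOT proved.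

## References
* [ArvindRaja2016] V. Arvind, S. Raja, *Some lower bound results for set-multilinear arithmetic
  computations*, Chicago J. Theoret. Comput. Sci. 2016, Art. 6 (doi:10.4086/cjtcs.2016.006), Remark 1.1
  and Thm. (sum of ROABPs).
* [RazYehudayoff2009] R. Raz, A. Yehudayoff, *Lower bounds and separations for constant depth
  multilinear circuits*, Comput. Complexity 18 (2009) 171–207, Thm. 1.1.
* [NisanWigderson1996] N. Nisan, A. Wigderson, *Lower bounds on arithmetic circuits via partial
  derivatives*, Comput. Complexity 6 (1996/97), §3.
* [Ryser1963] H. J. Ryser, *Combinatorial Mathematics*, Carus Monograph 14 (1963), Ch. 2 Thm. 4.1.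
-/

-- layout Summits/ValiantsHypothesis/ValiantsHypothesis forces the duplicated namespace component
set_option linter.dupNamespace false

namespace Summit.ValiantsHypothesis.ValiantsHypothesis.Theorems.RowSmlDepthFour

open Finset MvPolynomial Literature.Computability.AlgebraicComplexity

noncomputable section

/-- The value of a row-set-multilinear `ΣΠΣΠ` expression: `Σ_t ∏_(blocks b of π t) Σ_(u < w t)
∏_(rows i with π t i = b) q t b u i`. -/
def depthFourEval {R : Type*} [CommSemiring R] (n s : ℕ) (w : Fin s → ℕ)
    (π : Fin s → Fin n → Fin n)
    (q : (t : Fin s) → Fin n → Fin (w t) → Fin n → MvPolynomial (Fin n × Fin n) R) :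
    MvPolynomial (Fin n × Fin n) R :=
  ∑ t, ∏ b ∈ univ.image (π t), ∑ u : Fin (w t), ∏ i ∈ univ.filter (fun i => π t i = b), q t b u i

/-- Depth 3 inside depth 4: singleton blocks and inner fan-in `1`. [folklore] -/
theorem depthFourEval_singleton {R : Type*} [CommSemiring R] (n s : ℕ)
    (q₃ : Fin s → Fin n → MvPolynomial (Fin n × Fin n) R) :
    depthFourEval n s (fun _ => 1) (fun _ => id) (fun t _ _ i => q₃ t i) = ∑ t, ∏ i, q₃ t i := by
  unfold depthFourEval
  refine Finset.sum_congr rfl fun t _ => ?_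
  rw [Finset.image_id]
  refine Finset.prod_congr rfl fun b _ => ?_
  rw [Fin.sum_univ_one]
  have hb : univ.filter (fun i : Fin n => id i = b) = {b} := by
    ext i; simp
  rw [hb, Finset.prod_singleton]

/-- PIECE `A^ΣΠΣΠ_c` — the DEPTH-4 ROW-SET-MULTILINEAR RUNG of the threshold dial: along `n = mc`,
every row-set-multilinear `ΣΠΣΠ` expression of `per_n` with row-local bottom polynomials has size
`Σ_t w t > a·(m+1)^a·4^m`, eventually, for every `a`. TAG: OPEN for `c ≥ 3` (no `2^Ω(n)` lower
bound for multilinear depth 4 is in print — known: `2^(n^Ω(1/d))`, Raz–Yehudayoff 2009, Thm. 1.1);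
FALSE for `c ≤ 2` (`not_perRowSmlDepthFourHardExp`);
WEAKER than `SmThreshold.PerSmHardExp c`; implies the decided depth-3 statement
(`rowLocal_hard_of_depthFour`). [cite: RazYehudayoff2009, Thm. 1.1; ArvindRaja2016, Remark 1.1] -/
def PerRowSmlDepthFourHardExp (c : ℕ) : Prop :=
  ∀ a : ℕ, ∃ m : ℕ, ∀ (s : ℕ) (w : Fin s → ℕ) (π : Fin s → Fin (m * c) → Fin (m * c))
    (q : (t : Fin s) → Fin (m * c) → Fin (w t) → Fin (m * c) →
      MvPolynomial (Fin (m * c) × Fin (m * c)) ℂ),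
    (∀ t b u i, ∃ g : MvPolynomial (Fin (m * c)) ℂ, q t b u i = rename (Prod.mk i) g) →
    perPoly (Fin (m * c)) ℂ = depthFourEval (m * c) s w π q →
    a * (m + 1) ^ a * 4 ^ m < ∑ t, w t

/-- The crux form of the rung: exponential depth-4 row-set-multilinear hardness of `per` at SOME
rate `2^((2/c)·n)`. OPEN. [cite: ArvindRaja2016, Remark 1.1] -/
@[conjecture] def PerRowSmlDepthFourExpHard : Prop := ∃ c : ℕ, PerRowSmlDepthFourHardExp c

/-- **`A^ΣΠΣΠ_c` fails for `c ≤ 2`**: Ryser's formula is a depth-4 expression of size `2^n`.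
[cite: Ryser1963, Ch. 2 Thm. 4.1] -/
theorem not_perRowSmlDepthFourHardExp {c : ℕ} (hc : c ≤ 2) : ¬ PerRowSmlDepthFourHardExp c := by
  intro h
  obtain ⟨m, hm⟩ := h 1
  obtain ⟨q₃, hq₃, hper⟩ := RyserFormula.exists_rowLocal_repr_perPoly (R := ℂ) (m * c)
  have hlt := hm (2 ^ (m * c)) (fun _ => 1) (fun _ => id) (fun t _ _ i => q₃ t i)
    (fun t _ _ i => hq₃ t i) (by rw [depthFourEval_singleton]; exact hper)
  simp only [Finset.sum_const, Finset.card_univ, Fintype.card_fin, smul_eq_mul, mul_one] at hlt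
  have hle : 2 ^ (m * c) ≤ 4 ^ m := by
    rw [show (4 : ℕ) = 2 ^ 2 by norm_num, ← pow_mul, pow_le_pow_iff_right₀ (by norm_num : 1 < 2)]
    nlinarith
  have : 4 ^ m ≤ 1 * (m + 1) ^ 1 * 4 ^ m := by
    rw [one_mul, pow_one]; exact Nat.le_mul_of_pos_left _ (Nat.succ_pos m)
  omega

/-- **Depth 4 ⟹ depth 3**: `A^ΣΠΣΠ_c` implies the (unfolded) depth-3 statement
`SmThreshold.PerRowLocalHardExp c`. [folklore] -/
theorem rowLocal_hard_of_depthFour {c : ℕ} (h : PerRowSmlDepthFourHardExp c) (a : ℕ) :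
    ∃ m : ℕ, ∀ (s : ℕ) (q : Fin s → Fin (m * c) → MvPolynomial (Fin (m * c) × Fin (m * c)) ℂ),
      (∀ t i, ∃ g : MvPolynomial (Fin (m * c)) ℂ, q t i = rename (Prod.mk i) g) →
      perPoly (Fin (m * c)) ℂ = ∑ t, ∏ i, q t i → a * (m + 1) ^ a * 4 ^ m < s := by
  obtain ⟨m, hm⟩ := h a
  refine ⟨m, fun s q hq hper => ?_⟩
  have hlt := hm s (fun _ => 1) (fun _ => id) (fun t _ _ i => q t i) (fun t _ _ i => hq t i)
    (by rw [depthFourEval_singleton]; exact hper)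
  simpa using hlt

/-- The `∃ c` form lives on `c ≥ 3`. [cite: Ryser1963, Ch. 2 Thm. 4.1] -/
theorem perRowSmlDepthFourExpHard_iff :
    PerRowSmlDepthFourExpHard ↔ ∃ c, 3 ≤ c ∧ PerRowSmlDepthFourHardExp c := by
  constructor
  · rintro ⟨c, hc⟩
    refine ⟨c, ?_, hc⟩
    by_contra h3
    exact not_perRowSmlDepthFourHardExp (by omega) hc
  · rintro ⟨c, -, hc⟩
    exact ⟨c, hc⟩

/-! ## The adapted case of the true side (block flattening law) -/

section Adapted

variable {F : Type*} [Field F]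

/-- Locality in a row set is closed under products (two factors). [folklore] -/
theorem isLocal_mul {n : ℕ} {S : Finset (Fin n)} {p p' : MvPolynomial (Fin n × Fin n) F}
    (hp : ∃ h : MvPolynomial {ij : Fin n × Fin n // ij.1 ∈ S} F, p = rename Subtype.val h)
    (hp' : ∃ h : MvPolynomial {ij : Fin n × Fin n // ij.1 ∈ S} F, p' = rename Subtype.val h) :
    ∃ h : MvPolynomial {ij : Fin n × Fin n // ij.1 ∈ S} F, p * p' = rename Subtype.val h := by
  obtain ⟨a, rfl⟩ := hp
  obtain ⟨b, rfl⟩ := hp'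
  exact ⟨a * b, (map_mul _ _ _).symm⟩

/-- Locality in a row set is closed under finite products. [folklore] -/
theorem isLocal_prod {n : ℕ} {S : Finset (Fin n)} {ι : Type*} (T : Finset ι)
    (p : ι → MvPolynomial (Fin n × Fin n) F)
    (hp : ∀ x ∈ T, ∃ h : MvPolynomial {ij : Fin n × Fin n // ij.1 ∈ S} F,
      p x = rename Subtype.val h) :
    ∃ h : MvPolynomial {ij : Fin n × Fin n // ij.1 ∈ S} F, ∏ x ∈ T, p x = rename Subtype.val h := by
  classical
  induction T using Finset.induction_on with
  | empty => exact ⟨1, by simp⟩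
  | insert a T ha ih =>
    rw [Finset.prod_insert ha]
    exact isLocal_mul (hp a (Finset.mem_insert_self _ _))
      (ih fun x hx => hp x (Finset.mem_insert_of_mem hx))

/-- Locality in a row set is closed under finite sums. [folklore] -/
theorem isLocal_sum {n : ℕ} {S : Finset (Fin n)} {ι : Type*} (T : Finset ι)
    (p : ι → MvPolynomial (Fin n × Fin n) F)
    (hp : ∀ x ∈ T, ∃ h : MvPolynomial {ij : Fin n × Fin n // ij.1 ∈ S} F,
      p x = rename Subtype.val h) :
    ∃ h : MvPolynomial {ij : Fin n × Fin n // ij.1 ∈ S} F, ∑ x ∈ T, p x = rename Subtype.val h := by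
  classical
  induction T using Finset.induction_on with
  | empty => exact ⟨0, by simp⟩
  | insert a T ha ih =>
    rw [Finset.sum_insert ha]
    obtain ⟨u, hu⟩ := hp a (Finset.mem_insert_self _ _)
    obtain ⟨v, hv⟩ := ih fun x hx => hp x (Finset.mem_insert_of_mem hx)
    exact ⟨u + v, by rw [hu, hv, map_add]⟩

/-- A row-local polynomial on a row of `S` is local in `S`. [folklore] -/
theorem isLocal_of_rowLocal {n : ℕ} {S : Finset (Fin n)} {i : Fin n} (hi : i ∈ S)
    {p : MvPolynomial (Fin n × Fin n) F}
    (hp : ∃ g : MvPolynomial (Fin n) F, p = rename (Prod.mk i) g) :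
    ∃ h : MvPolynomial {ij : Fin n × Fin n // ij.1 ∈ S} F, p = rename Subtype.val h := by
  obtain ⟨g, rfl⟩ := hp
  refine ⟨rename (fun j => (⟨(i, j), hi⟩ : {ij : Fin n × Fin n // ij.1 ∈ S})) g, ?_⟩
  rw [rename_rename]
  rfl

/-- **The adapted case of `A^ΣΠΣΠ` (PROVED).** If a nonempty row set `S` is respected by every
term of a row-set-multilinear `ΣΠΣΠ` expression of `per_n` (no block meets both `S` and `Sᶜ`),
then its size is at least `C(n,|S|)`. [cite: NisanWigderson1996, Thm. 3.2 (method)] -/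
theorem choose_le_size_of_adapted (n s : ℕ) (w : Fin s → ℕ) (π : Fin s → Fin n → Fin n)
    (q : (t : Fin s) → Fin n → Fin (w t) → Fin n → MvPolynomial (Fin n × Fin n) F)
    (hq : ∀ t b u i, ∃ g : MvPolynomial (Fin n) F, q t b u i = rename (Prod.mk i) g)
    (h : perPoly (Fin n) F = depthFourEval n s w π q)
    (S : Finset (Fin n)) (hS : S.Nonempty)
    (hadapt : ∀ t i i', π t i = π t i' → (i ∈ S ↔ i' ∈ S)) :
    n.choose S.card ≤ ∑ t, w t := by
  classical
  -- the block polynomials, the blocks inside `S`, and the two halves of each term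
  let Q : (t : Fin s) → Fin n → MvPolynomial (Fin n × Fin n) F :=
    fun t b => ∑ u : Fin (w t), ∏ i ∈ univ.filter (fun i => π t i = b), q t b u i
  let inS : Fin s → Fin n → Prop := fun t b => ∃ i ∈ S, π t i = b
  let Fp : Fin s → MvPolynomial (Fin n × Fin n) F :=
    fun t => ∏ b ∈ (univ.image (π t)).filter (fun b => inS t b), Q t b
  let Gp : Fin s → MvPolynomial (Fin n × Fin n) F :=
    fun t => ∏ b ∈ (univ.image (π t)).filter (fun b => ¬ inS t b), Q t b
  have hterm : ∀ t, ∏ b ∈ univ.image (π t), Q t b = Fp t * Gp t := fun t =>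
    (Finset.prod_filter_mul_prod_filter_not _ _ _).symm
  have hper : perPoly (Fin n) F = ∑ t, Fp t * Gp t := by
    rw [h]
    exact Finset.sum_congr rfl fun t _ => hterm t
  -- locality of the two halves
  have hF : ∀ t, ∃ hh : MvPolynomial {ij : Fin n × Fin n // ij.1 ∈ S} F,
      Fp t = rename Subtype.val hh := by
    intro t
    refine isLocal_prod _ _ fun b hb => ?_
    obtain ⟨i₀, hi₀S, hi₀⟩ := (Finset.mem_filter.mp hb).2
    refine isLocal_sum _ _ fun u _ => isLocal_prod _ _ fun i hi => ?_
    have hπ : π t i = b := (Finset.mem_filter.mp hi).2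
    have hiS : i ∈ S := (hadapt t i i₀ (hπ.trans hi₀.symm)).mpr hi₀S
    exact isLocal_of_rowLocal hiS (hq t b u i)
  have hG : ∀ t, ∃ hh : MvPolynomial {ij : Fin n × Fin n // ij.1 ∈ Sᶜ} F,
      Gp t = rename Subtype.val hh := by
    intro t
    refine isLocal_prod _ _ fun b hb => ?_
    have hnot : ¬ inS t b := (Finset.mem_filter.mp hb).2
    refine isLocal_sum _ _ fun u _ => isLocal_prod _ _ fun i hi => ?_
    have hπ : π t i = b := (Finset.mem_filter.mp hi).2
    have hiS : i ∈ Sᶜ := Finset.mem_compl.mpr fun hiS => hnot ⟨i, hiS, hπ⟩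
    exact isLocal_of_rowLocal hiS (hq t b u i)
  -- terms with `w t = 0` vanish (a block inside `S` exists since `S ≠ ∅`)
  have hzero : ∀ t, w t = 0 → Fp t * Gp t = 0 := by
    intro t ht
    obtain ⟨i₀, hi₀⟩ := hS
    have hb : π t i₀ ∈ (univ.image (π t)).filter (fun b => inS t b) :=
      Finset.mem_filter.mpr ⟨Finset.mem_image_of_mem _ (mem_univ _), i₀, hi₀, rfl⟩
    have hQ0 : Q t (π t i₀) = 0 := by
      haveI : IsEmpty (Fin (w t)) := by rw [ht]; infer_instance
      simp only [Q, Finset.univ_eq_empty, Finset.sum_empty]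
    have hF0 : Fp t = 0 := Finset.prod_eq_zero hb hQ0
    rw [hF0, zero_mul]
  -- re-index the nonzero terms by `Fin s'`
  let T := {t : Fin s // 0 < w t}
  let e := Fintype.equivFin T
  have hper' : perPoly (Fin n) F =
      ∑ k : Fin (Fintype.card T), Fp (e.symm k).1 * Gp (e.symm k).1 := by
    rw [hper]
    have h1 : ∑ t, Fp t * Gp t = ∑ t ∈ univ.filter (fun t => 0 < w t), Fp t * Gp t := by
      rw [Finset.sum_filter]
      refine Finset.sum_congr rfl fun t _ => ?_
      by_cases ht : 0 < w t
      · rw [if_pos ht]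
      · rw [if_neg ht, hzero t (by omega)]
    rw [h1, Finset.sum_subtype (univ.filter (fun t => 0 < w t))
      (p := fun t => 0 < w t) (fun t => by simp)]
    exact (Equiv.sum_comp e.symm (fun x : T => Fp x.1 * Gp x.1)).symm
  -- the block flattening law, and `|T| ≤ Σ_t w t`
  have hle := RowPartitionRank.choose_le_of_perPoly_eq_sum_mul_blockLocal n (Fintype.card T) S
    (fun k => Fp (e.symm k).1) (fun k => Gp (e.symm k).1) (fun k => hF _) (fun k => hG _) hper'
  have hcard : Fintype.card T ≤ ∑ t, w t := by
    rw [Fintype.card_subtype]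
    calc (univ.filter (fun t => 0 < w t)).card
          = ∑ t ∈ univ.filter (fun t => 0 < w t), 1 := Finset.card_eq_sum_ones _
      _ ≤ ∑ t ∈ univ.filter (fun t => 0 < w t), w t :=
          Finset.sum_le_sum fun t ht => (Finset.mem_filter.mp ht).2
      _ ≤ ∑ t, w t :=
          Finset.sum_le_sum_of_subset_of_nonneg (Finset.filter_subset _ _)
            (fun _ _ _ => Nat.zero_le _)
  exact hle.trans hcard

/-- Corollary: an expression adapted to a BALANCED cut (`|S| = ⌊n/2⌋`, e.g. a generalized Laplace
expansion along `S`) has size `≥ C(n,⌊n/2⌋) ≥ 2^n/(n+1)`. [cite: NisanWigderson1996, Thm. 3.2 (method)] -/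
theorem choose_half_le_size_of_adapted (n s : ℕ) (w : Fin s → ℕ)
    (π : Fin s → Fin n → Fin n)
    (q : (t : Fin s) → Fin n → Fin (w t) → Fin n → MvPolynomial (Fin n × Fin n) F)
    (hq : ∀ t b u i, ∃ g : MvPolynomial (Fin n) F, q t b u i = rename (Prod.mk i) g)
    (h : perPoly (Fin n) F = depthFourEval n s w π q)
    (S : Finset (Fin n)) (hSc : S.card = n / 2) (hn : 2 ≤ n)
    (hadapt : ∀ t i i', π t i = π t i' → (i ∈ S ↔ i' ∈ S)) :
    n.choose (n / 2) ≤ ∑ t, w t := by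
  have hS : S.Nonempty := by
    rw [← Finset.card_pos, hSc]; omega
  simpa [hSc] using choose_le_size_of_adapted n s w π q hq h S hS hadapt

end Adapted

end

end Summit.ValiantsHypothesis.ValiantsHypothesis.Theorems.RowSmlDepthFour
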